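import Summits.BirchSwinnertonDyer.Rank1Residual.ManinAdditive.ThetaFourSqOmega
import HarnessLib
import HarnessLib.Audit.Tags

/-!
# Theta visibility on `Iₙ*` with `3 ∣ n`: the level-lowering supplement (rows E-desc-157₃ / 157₄ + PROVED E-desc-159e / 159f)
(cell bsd-f2-manin, desc lens g22, MEMO-desc §47.14–47.15; SIBLING 3 of the landed `ThetaFourOmega.lean`; imports SIBLING 2
`ThetaFourSqOmega.lean` (T-desc-42) for `WeightedDifferenceNotThreeDivisible`; same namespace; nothing under `@[conjecture]` is
asserted; the assembly is PROVED bookkeeping).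

SATURATED-DEPTH CENSUS (kit j335445 + j335453, engine imc ENGINE 7 + desc patch `nb/neronomega_theta_v.gp`; HOME/desc/g22/nb/THV-table.md):
for each optimal class at `N = 9M ≤ 549` the depth of `f_E` inside `Ω₃ ∩ V` for `V` = theta span / theta + χ₋₃-twists of `S₂(Γ₀(M))` /
theta + old forms from `3M` / everything: **LAW THV-1** `depth(θ ⊕ tw) = ord₃ r_Ω` (the full Néron line depth) 52/52 classes (all Kodaira
types, incl. the `I₀*` twists and the out-of-sample levels 477/495/549); **THV-2** saturating the theta span adds nothing 52/52; **THV-3** old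
forms from `3M` add nothing 52/52.  So the `3`-adic congruence depth of `f_E` inside imc's `Ω₃(9M)` is exhausted by (quaternionic theta
series of `B_{3,∞}` at level 9M) ⊕ (χ₋₃-twists of level `M`): the Brandt-height part + the level-lowering part.  v2 (kit j335548,
`N = 1017 = 9·113`, HOME/desc/g22/nb/THV-table-1017.md): 912/912 theta vectors in `Ω₃`; THV-1/2/3 12/12 (running total 64/64 at 20 levels);
the two `I₉*` classes show the level-lowering part is worth `v₃(n)`, not `[3 ∣ n]` — row E-desc-157₄ (uniform in `n`) and the PROVED
uniform assembly E-desc-159f (no hypothesis on `n`).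
PARTITION 0 · beyond-print theorem: no · `3 ∤ c_E` is NOT proved by this; BSD is not proved by this; C3 OPEN.

TYPER NOTE (typer g21, T-desc-43 v2).  SOURCE = HOME/desc/g22/Sketch-desc-g22d2.lean sha16 c148d0c552c16163 (221 l. = Sketch-desc-g22d.lean
429f1d61c69efb3d l.1–119 + `section GlueVal`; desc: farm rc 0·0·0·0, BC7 1/1 CLEAN bc7-g22d2.raw.txt c45c19cbb1510018; MEMO-desc §47.14–47.15,
extract HOME/desc/g22/memo47g.md 0ee09cb0b5d096f1; censuses nb/THV-table.md, nb/THV-table-1017.md ee83be75090b9786, kit j335445/j335453/j335548)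
VERBATIM — desc's header above, every body/docstring below; v1 was never in flight, so v2 lands whole (no append).  Imports: landed SIBLING 2
`…ManinAdditive.ThetaFourSqOmega` (p741537, Theses-free) + HarnessLib(+Audit.Tags); namespace `…ManinAdditive.ThetaFourOmega`.  ROWS (desc's
`@[conjecture]` tags, nothing asserted): **E-desc-157₃ `ThetaTwistOmegaWitnessAtNinePrime`**, **E-desc-157₄ `ThetaTwistOmegaWitnessValAtNinePrime`**
(uniform in n: `ord₃ q + v₃(6H(g)) + padicValNat 3 |v₃ j| ≤ 1`); PROVED `thetaTwistOmegaWitness_of_val` (157₄ ⟹ 157₃), **E-desc-159e / E-desc-159f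
`manin_at_three_of_thetaTwistWitnessVal_of_degreeLaw`** (157₄ ∧ E-124 literal ∧ GIVEN ∧ optimality ⟹ ¬3 ∣ c ∧ NeronCongruenceDepthAt 3 on ALL Iₙ*;
supersedes 159d's 3 ∤ n restriction).  BC5: THV-1/2/3 laws 64/64 at 20 levels; E-desc-156 2958/2958.  REFUTER: ref1/ref2 R-desc-38 += 157₄ PENDING at
landing.  Typer checks: 7 decl names fresh; cite keys CremonaEcdata / Ribet1990 present; no instances, no notation, no sorry.  PARTITION 0 ·
beyond-print theorem: no · bears_on: stmt-BirchSwinnertonDyer-22968 (C3).  `3 ∤ c_E` is NOT proved by this; BSD is not proved by this; C3 OPEN.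
-/

namespace Summit.BirchSwinnertonDyer.Rank1Residual.ManinAdditive.ThetaFourOmega

open scoped MatrixGroups ModularForm
open CongruenceSubgroup WeierstrassCurve Literature.NumberTheory.EllipticCurves
open Literature.NumberTheory.EllipticCurves.ModularForms
open Summit.BirchSwinnertonDyer.Rank1Residual.ManinAdditive.HurwitzBrandt (DQuat)
open Summit.BirchSwinnertonDyer.Rank1Residual.ManinAdditive.ThetaFourBrandt
open Summit.BirchSwinnertonDyer.Rank1Residual.ManinAdditive.NeronOmegaThree

/-! ### The level-lowering supplement on `Iₙ*` with `3 ∣ n` (desc g22, MEMO-desc §47.14) -/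

/-- **Row E-desc-157₃ `ThetaTwistOmegaWitnessAtNinePrime`** (LAW-candidate; desc g22, MEMO-desc §47.14; nothing asserted).  On the `Iₙ*`
classes with `3 ∣ n` the cuspidal theta series of the `θ₄²`-module stop ONE short of the Néron line depth, and the saturation of
`Ω₃ ∩ (theta span ⊕ χ₋₃-twists of S₂(Γ₀(p)))` supplies the missing unit (kit j335445/j335453, HOME/desc/g22/nb/THV-table.md:
`d_θ = 0`, `d_{θ+tw} = 1 = ord₃ r_Ω`, `d_{θ+old(3p)} = 0` on ALL THREE such classes `9p ≤ 549` — 99b1, 387d1, 423b1; more generally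
`d_{θ+tw} = ord₃ r_Ω` on 52/52 optimal classes of every Kodaira type, old forms from `3p` never contribute, 52/52).  Reading: `3 ∣ n = #Φ₃(E ⊗ χ₋₃)` makes `ρ̄_{E⊗χ₋₃,3}` finite at 3, so (Ribet/Mazur level lowering
mod 3, `ρ̄` irreducible) `E ⊗ χ₋₃ ≡ h (mod 𝔩)` for a newform `h` of level `p`, i.e. `f_E ≡ h ⊗ χ₋₃ (mod 𝔩)` — a congruence INVISIBLE to
`B_{3,∞}` (principal series at 3) that adds one to the congruence depth inside `Ω₃`.  Statement: conductor `9p`, `n = −v₃(j) ≥ 1` with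
`3 ∣ n`, `g` a unit-invariant `θ₄²`-eigenvector with `3 ∤ cont(Wg)` and `Wg ≢ const (mod 3)` ⟹ SOME `x ∈ Ω₃(9p)` has `f_E`-coordinate `q`
with `ord₃ q ≤ −v₃(6⟨g,g⟩)` (one deeper than E-desc-157₂).  Why it might fail: a `3 ∣ n` class whose level-lowered congruence is
Eisenstein after all, or where the twist congruence and the theta part do not add (depth of a sum of lattices is not additive in
general). [cite: CremonaEcdata] [cite: Ribet1990, Thm. 1.1 (level lowering; mechanism only)] -/
@[conjecture]
def ThetaTwistOmegaWitnessAtNinePrime : Prop :=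
  ∀ (p : ℕ), p.Prime → 5 ≤ p →
  ∀ (W : WeierstrassCurve ℚ) [W.IsElliptic] [NeZero (W.conductorNorm ℤ)]
    (D : ModularParametrizationData W (W.conductorNorm ℤ)),
    W.conductorNorm ℤ = 9 * p → padicValRat 3 W.j < 0 → (3 : ℤ) ∣ padicValRat 3 W.j →
  ∀ g : Fin (p + 1) → ZI,
    IsUnitInvariant3 p g → IsThetaFourSqHeckeEigen p g (fun n => W.LFunction n) →
    WeightedNotThreeDivisible p g → WeightedDifferenceNotThreeDivisible p g →
    ∃ x ∈ omegaLatticeAtThree (W.conductorNorm ℤ), ∃ q : ℚ, q ≠ 0 ∧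
      (q : ℂ) * peterssonProduct (Gamma0 (W.conductorNorm ℤ)) 2 D.f D.f =
        peterssonProduct (Gamma0 (W.conductorNorm ℤ)) 2 D.f x ∧
      padicValRat 3 q + padicValInt 3 (thetaFourHeightSix p g) ≤ 0

section GlueTwist

/-- Pure arithmetic: `3 m² d = 4 n H` with `3 ∥ n` gives `v₃ d ≤ v₃ H` (indeed `v₃ H = v₃ d + 2 v₃ m`). -/
theorem height_val_of_sqDegreeLaw_three {d m : ℕ} (hd : 0 < d) (hm : 1 ≤ m) {n H : ℤ} (hn : (3 : ℤ) ∣ n)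
    (hn9 : ¬ (9 : ℤ) ∣ n) (h : 3 * (m : ℤ) ^ 2 * (d : ℤ) = 4 * n * H) : padicValNat 3 d ≤ padicValInt 3 H := by
  haveI : Fact (Nat.Prime 3) := ⟨Nat.prime_three⟩
  have hn0 : n ≠ 0 := by rintro rfl; exact hn9 (dvd_zero 9)
  have hH : H ≠ 0 := by
    rintro rfl
    have : (3 * (m : ℤ) ^ 2) * (d : ℤ) = 0 := by simpa using h
    rcases mul_eq_zero.mp this with h0 | h0
    · have : (m : ℤ) = 0 := by
        rcases mul_eq_zero.mp h0 with h3 | hm2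
        · norm_num at h3
        · exact pow_eq_zero_iff (n := 2) (by norm_num) |>.mp hm2
      omega
    · exact hd.ne' (by exact_mod_cast h0)
  have hnat : 3 * m ^ 2 * d = 4 * n.natAbs * H.natAbs := by
    have := congrArg Int.natAbs h
    simpa [Int.natAbs_mul, Int.natAbs_pow] using this
  have hHn : H.natAbs ≠ 0 := Int.natAbs_ne_zero.mpr hH
  have hnn : n.natAbs ≠ 0 := Int.natAbs_ne_zero.mpr hn0
  have h34 : padicValNat 3 4 = 0 := padicValNat.eq_zero_of_not_dvd (by norm_num)
  have h33 : padicValNat 3 3 = 1 := padicValNat_self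
  have h3n : 3 ^ 1 ∣ n.natAbs := by
    rw [pow_one]; exact Int.natAbs_dvd_natAbs.mpr (by simpa using hn)
  have h9n : ¬ 3 ^ 2 ∣ n.natAbs := fun h9 =>
    hn9 (Int.natAbs_dvd_natAbs.mp (by simpa using h9))
  have hvn1 : 1 ≤ padicValNat 3 n.natAbs := (padicValNat_dvd_iff_le hnn).mp h3n
  have hvn2 : ¬ 2 ≤ padicValNat 3 n.natAbs := fun h2 => h9n ((padicValNat_dvd_iff_le hnn).mpr h2)
  have hv := congrArg (padicValNat 3) hnat
  rw [padicValNat.mul (by positivity) hd.ne', padicValNat.mul (by norm_num) (by positivity), h33,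
    padicValNat.mul (by positivity) hHn, padicValNat.mul (by norm_num) hnn, h34] at hv
  simp only [padicValInt]
  omega

variable {p : ℕ} {W : WeierstrassCurve ℚ} [W.IsElliptic] [W.IsGloballyMinimal] [NeZero (W.conductorNorm ℤ)]
  {D : ModularParametrizationData W (W.conductorNorm ℤ)}

/-- **E-desc-159e (PROVED assembly on `Iₙ*` with `3 ∥ n`, prime level).**  E-desc-157₃ ∧ E-desc-124 (literal) ∧ imc's GIVEN row
⟹ for every `X₀(9p)`-optimal curve of type `Iₙ*` at 3 with `3 ∥ n` carrying a primitive unit-invariant `θ₄²`-eigenvector with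
`3 ∤ cont(Wg)`, `Wg ≢ const (mod 3)`: `3 ∤ c_E` and Néron congruence depth at 3.  (With E-desc-159d this covers every `Iₙ*`
with `9 ∤ n`; the census `9p ≤ 549` has no `9 ∣ n`.) -/
theorem manin_at_three_of_thetaTwistWitness_of_degreeLaw (hΘ : ThetaTwistOmegaWitnessAtNinePrime)
    (hdeg : ThetaFourSqBrandtDegreeLawAtNinePrime) (hp : p.Prime) (h5 : 5 ≤ p) (Δ : NeronFLineDatum W D)
    (hN : W.conductorNorm ℤ = 9 * p) (hΩ : IsOmegaNeronAtThree Δ)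
    (hopt : ∀ z ∈ D.L.lattice, ∃ w ∈ periodLattice D.f, z = D.c * w)
    (hmin : ∀ (W' : WeierstrassCurve ℚ) [W'.IsElliptic] (D' : ModularParametrizationData W' (W.conductorNorm ℤ)),
        D'.f = D.f → D.modularDegree ≤ D'.modularDegree)
    (hj : padicValRat 3 W.j < 0) (hn3 : (3 : ℤ) ∣ padicValRat 3 W.j) (hn9 : ¬ (9 : ℤ) ∣ padicValRat 3 W.j)
    {g : Fin (p + 1) → ZI} (hU : IsUnitInvariant3 p g) (hprim : IsPrimitive3 p g)
    (hH : IsThetaFourSqHeckeEigen p g (fun n => W.LFunction n)) (hW : WeightedNotThreeDivisible p g)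
    (hWd : WeightedDifferenceNotThreeDivisible p g) :
    ¬ (3 : ℤ) ∣ D.maninConstant ∧ Δ.NeronCongruenceDepthAt 3 := by
  obtain ⟨m, hm1, _hm5, hlaw⟩ := hdeg p hp h5 W D hN hopt hmin hj g hU hprim hH
  have hn3' : (3 : ℤ) ∣ -padicValRat 3 W.j := (dvd_neg).mpr hn3
  have hn9' : ¬ (9 : ℤ) ∣ -padicValRat 3 W.j := fun h => hn9 ((dvd_neg).mp h)
  have hv := height_val_of_sqDegreeLaw_three (d := D.modularDegree) D.deg_pos hm1 hn3' hn9' hlaw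
  have hv' : (padicValNat 3 D.modularDegree : ℤ) ≤ (padicValInt 3 (thetaFourHeightSix p g) : ℤ) := by
    exact_mod_cast hv
  obtain ⟨x, hx, q, hq0, hq, hval⟩ := hΘ p hp h5 W D hN hj hn3 g hU hH hW hWd
  exact manin_and_depth_of_omegaWitness Δ hΩ hx hq0 hq (by omega)

end GlueTwist


/-! ### The uniform `Iₙ*` supplement: the level-lowering part is worth `v₃(n)` (desc g22, MEMO-desc §47.15; kit j335548, `N = 1017`) -/

/-- **Row E-desc-157₄ `ThetaTwistOmegaWitnessValAtNinePrime`** (LAW-candidate, uniform in `n = −v₃(j) ≥ 1`; desc g22, MEMO-desc §47.15;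
nothing asserted; it implies E-desc-157₃ — `thetaTwistOmegaWitness_of_val` below — and, on `Iₙ*`, the bound of E-desc-157₂, and sharpens
both when `9 ∣ n`).  SOME `x ∈ Ω₃(9p)` has `f_E`-coordinate `q` with `ord₃ q ≤ 1 − v₃(6⟨g,g⟩) − v₃(n)`.  Evidence (kit j335548,
`N = 1017 = 9·113`: 912/912 theta vectors in `Ω₃`, saturated depths; HOME/desc/g22/nb/THV-table-1017.md): the two `I₉*` classes 1017i1,
1017l1 have theta depth `0 = v₃⟨g,g⟩` but `Ω₃ ∩ (theta span ⊕ χ₋₃-twists of S₂(Γ₀(113)))`-depth `2 = ord₃ r_Ω = v₃ deg φ`, and the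
`I₃*` class 1017k1 has `0` and `1`: the level-lowered congruence `f_E ≡ h ⊗ χ₋₃` is worth `v₃(n)` (a congruence modulo `3^{v₃ n}`, as
`#Φ₃(E ⊗ χ₋₃) = n` suggests), not `[3 ∣ n]`.  Together with the 24 `Iₙ*` classes `9M ≤ 549` meeting the hypotheses
(HOME/desc/g22/nb/THV-table.md, nb/E157sq-check.txt): `depth(Ω₃ ∩ (θ ⊕ tw)) = v₃⟨g,g⟩ + v₃(n) = ord₃ r_Ω` on 27/27 (`v₃ n = 0`: 21,
`= 1`: 4, `= 2`: 2).  Why it might fail: a class with `9 ∣ n` whose congruence with the level-lowered twist holds only modulo `3`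
(depth `v₃⟨g,g⟩ + 1`), or non-additivity of the theta part and the twist part of `Ω₃`. [cite: CremonaEcdata]
[cite: Ribet1990, Thm. 1.1 (level lowering; mechanism only)] -/
@[conjecture]
def ThetaTwistOmegaWitnessValAtNinePrime : Prop :=
  ∀ (p : ℕ), p.Prime → 5 ≤ p →
  ∀ (W : WeierstrassCurve ℚ) [W.IsElliptic] [NeZero (W.conductorNorm ℤ)]
    (D : ModularParametrizationData W (W.conductorNorm ℤ)),
    W.conductorNorm ℤ = 9 * p → padicValRat 3 W.j < 0 →
  ∀ g : Fin (p + 1) → ZI,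
    IsUnitInvariant3 p g → IsThetaFourSqHeckeEigen p g (fun n => W.LFunction n) →
    WeightedNotThreeDivisible p g → WeightedDifferenceNotThreeDivisible p g →
    ∃ x ∈ omegaLatticeAtThree (W.conductorNorm ℤ), ∃ q : ℚ, q ≠ 0 ∧
      (q : ℂ) * peterssonProduct (Gamma0 (W.conductorNorm ℤ)) 2 D.f D.f =
        peterssonProduct (Gamma0 (W.conductorNorm ℤ)) 2 D.f x ∧
      padicValRat 3 q + padicValInt 3 (thetaFourHeightSix p g) + padicValNat 3 (padicValRat 3 W.j).natAbs ≤ 1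

section GlueVal

/-- E-desc-157₄ ⟹ E-desc-157₃ (`3 ∣ n` gives `v₃ n ≥ 1`). -/
theorem thetaTwistOmegaWitness_of_val (h : ThetaTwistOmegaWitnessValAtNinePrime) :
    ThetaTwistOmegaWitnessAtNinePrime := by
  intro p hp h5 W _ _ D hN hj hn3 g hU hH hW hWd
  obtain ⟨x, hx, q, hq0, hq, hval⟩ := h p hp h5 W D hN hj g hU hH hW hWd
  refine ⟨x, hx, q, hq0, hq, ?_⟩
  haveI : Fact (Nat.Prime 3) := ⟨Nat.prime_three⟩
  have hne : (padicValRat 3 W.j).natAbs ≠ 0 := Int.natAbs_ne_zero.mpr hj.ne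
  have h3 : 3 ^ 1 ∣ (padicValRat 3 W.j).natAbs := by
    rw [pow_one]; exact Int.natAbs_dvd_natAbs.mpr (by simpa using hn3)
  have h1 : 1 ≤ padicValNat 3 (padicValRat 3 W.j).natAbs := (padicValNat_dvd_iff_le hne).mp h3
  omega

/-- Pure arithmetic: `3 m² d = 4 n H` (`d, m ≥ 1`) gives `v₃ d + 1 + 2 v₃ m = v₃ n + v₃ H`, so `v₃ d + 1 ≤ v₃ H + v₃ n`. -/
theorem height_val_of_sqDegreeLaw_val {d m : ℕ} (hd : 0 < d) (hm : 1 ≤ m) {n H : ℤ}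
    (h : 3 * (m : ℤ) ^ 2 * (d : ℤ) = 4 * n * H) :
    padicValNat 3 d + 1 ≤ padicValInt 3 H + padicValNat 3 n.natAbs := by
  haveI : Fact (Nat.Prime 3) := ⟨Nat.prime_three⟩
  have hm0 : m ≠ 0 := by omega
  have hL : 3 * (m : ℤ) ^ 2 * (d : ℤ) ≠ 0 := by
    have hm0' : (m : ℤ) ≠ 0 := by exact_mod_cast hm0
    have hd0 : (d : ℤ) ≠ 0 := by exact_mod_cast hd.ne'
    exact mul_ne_zero (mul_ne_zero (by norm_num) (pow_ne_zero 2 hm0')) hd0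
  have hn0 : n ≠ 0 := by rintro rfl; exact hL (by rw [h]; ring)
  have hH : H ≠ 0 := by rintro rfl; exact hL (by rw [h]; ring)
  have hnat : 3 * m ^ 2 * d = 4 * n.natAbs * H.natAbs := by
    have := congrArg Int.natAbs h
    simpa [Int.natAbs_mul, Int.natAbs_pow] using this
  have hHn : H.natAbs ≠ 0 := Int.natAbs_ne_zero.mpr hH
  have hnn : n.natAbs ≠ 0 := Int.natAbs_ne_zero.mpr hn0
  have h34 : padicValNat 3 4 = 0 := padicValNat.eq_zero_of_not_dvd (by norm_num)
  have h33 : padicValNat 3 3 = 1 := padicValNat_self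
  have hv := congrArg (padicValNat 3) hnat
  rw [padicValNat.mul (by positivity) hd.ne', padicValNat.mul (by norm_num) (by positivity), h33,
    padicValNat.mul (by positivity) hHn, padicValNat.mul (by norm_num) hnn, h34] at hv
  simp only [padicValInt]
  omega

variable {p : ℕ} {W : WeierstrassCurve ℚ} [W.IsElliptic] [W.IsGloballyMinimal] [NeZero (W.conductorNorm ℤ)]
  {D : ModularParametrizationData W (W.conductorNorm ℤ)}

/-- **E-desc-159f (PROVED assembly on ALL of Kodaira type `Iₙ*`, `n ≥ 1`, prime level).**  E-desc-157₄ ∧ E-desc-124 (literal) ∧ imc's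
GIVEN row ⟹ for every `X₀(9p)`-optimal curve of type `Iₙ*` at 3 carrying a primitive unit-invariant `θ₄²`-eigenvector with
`3 ∤ cont(Wg)`, `Wg ≢ const (mod 3)`: `3 ∤ c_E` and Néron congruence depth at 3 — with NO hypothesis on `n` (supersedes the split
E-desc-159d (`3 ∤ n`) / 159e (`3 ∥ n`); the `3`-parts of `m` and `n` only help: `v₃ deg φ + 1 + 2 v₃ m = v₃ n + v₃(6⟨g,g⟩)`). -/
theorem manin_at_three_of_thetaTwistWitnessVal_of_degreeLaw (hΘ : ThetaTwistOmegaWitnessValAtNinePrime)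
    (hdeg : ThetaFourSqBrandtDegreeLawAtNinePrime) (hp : p.Prime) (h5 : 5 ≤ p) (Δ : NeronFLineDatum W D)
    (hN : W.conductorNorm ℤ = 9 * p) (hΩ : IsOmegaNeronAtThree Δ)
    (hopt : ∀ z ∈ D.L.lattice, ∃ w ∈ periodLattice D.f, z = D.c * w)
    (hmin : ∀ (W' : WeierstrassCurve ℚ) [W'.IsElliptic] (D' : ModularParametrizationData W' (W.conductorNorm ℤ)),
        D'.f = D.f → D.modularDegree ≤ D'.modularDegree)
    (hj : padicValRat 3 W.j < 0)
    {g : Fin (p + 1) → ZI} (hU : IsUnitInvariant3 p g) (hprim : IsPrimitive3 p g)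
    (hH : IsThetaFourSqHeckeEigen p g (fun n => W.LFunction n)) (hW : WeightedNotThreeDivisible p g)
    (hWd : WeightedDifferenceNotThreeDivisible p g) :
    ¬ (3 : ℤ) ∣ D.maninConstant ∧ Δ.NeronCongruenceDepthAt 3 := by
  obtain ⟨m, hm1, _hm5, hlaw⟩ := hdeg p hp h5 W D hN hopt hmin hj g hU hprim hH
  have hv := height_val_of_sqDegreeLaw_val (d := D.modularDegree) D.deg_pos hm1 hlaw
  rw [Int.natAbs_neg] at hv
  have hv' : (padicValNat 3 D.modularDegree : ℤ) + 1 ≤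
      (padicValInt 3 (thetaFourHeightSix p g) : ℤ) + (padicValNat 3 (padicValRat 3 W.j).natAbs : ℤ) := by
    exact_mod_cast hv
  obtain ⟨x, hx, q, hq0, hq, hval⟩ := hΘ p hp h5 W D hN hj g hU hH hW hWd
  exact manin_and_depth_of_omegaWitness Δ hΩ hx hq0 hq (by omega)

end GlueVal

end Summit.BirchSwinnertonDyer.Rank1Residual.ManinAdditive.ThetaFourOmega
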